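import Literature.NumberTheory.Automorphic.UnitaryLineArchTypes
import Literature.NumberTheory.Automorphic.SeesawTorusCharacters
import Literature.RepresentationTheory.CompactGroups.CircleCharacters
import HarnessLib

/-!
# Archimedean exponents of characters and of stable lines of the torus `U(W)(L⁺ ⊗ ℝ)`
# (Bröcker–tom Dieck II (8.1)/(8.2) for `∏_{w ∣ ∞} U(1)`): every type EXISTS and is unique

Topic `NumberTheory/Automorphic`; namespace `Literature.NumberTheory.Automorphic` (sub-namespaces
`UnitaryLineChar`, `SeesawTorus`).  For a hermitian line `W` over a CM extension `L/L⁺` the archimedean torus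
`U(W)(L⁺ ⊗ ℝ) = relNormOneInfUnits L⁺ L` is `∏_{w ∣ ∞} U(1)` (`relNormOneInfUnitsEquivCircles`, one-place subtori
`archCoord L w`, file `UnitaryLineArchTypes`), and the TYPED WEIGHTS are `archWeight L m : t ↦ ∏_w ι_w(t_w)^{m_w}`
(`UnitaryLineCharacters`).  The tree so far has the UNIQUENESS of the type (`archWeight_injective`,
`UnitaryLineChar.HasArchType.unique`) and, for ONE circle, the classification of continuous characters
(`CircleChar.existsUnique_zpow_complex`, `CircleChar.existsUnique_lineExponent`, file
`RepresentationTheory/CompactGroups/CircleCharacters`, [BrockerTomDieck1985] Ch. II Prop. (8.1), Def. (8.2)).  This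
file puts them together — EXISTENCE of the type, all places at once:

* § 1 **characters of the archimedean torus**: a continuous homomorphism `c : U(W)(L⁺ ⊗ ℝ) →* ℂ` (resp. `→* U(1)`)
  IS `archWeight L m` (resp. `archWeightCircle L m`) for a UNIQUE `m : (w ∣ ∞) → ℤ` — `existsUnique_archWeight_eq`,
  `existsUnique_archWeightCircle_eq`; the exponent as DATA `charArchType L c hc` with `archWeight_charArchType`,
  `charArchType_eq_iff`, `charArchType_archWeight`.
* § 2 **stable lines** (the form in which (8.1) DEFINES integer invariants, Def. (8.2)): a multiplicative action `ρ`
  of `U(W)(L⁺ ⊗ ℝ)` by `ℂ`-linear maps on a vector space stabilising the line through `φ ≠ 0`, `ρ t φ = c t • φ`,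
  with `c` continuous — or, in a Hausdorff topological vector space, with continuous orbit `t ↦ ρ t φ` — acts there
  by `archWeight L m` for a UNIQUE `m`: `existsUnique_archWeight_of_line`, `existsUnique_archWeight_of_line_of_continuous`;
  the exponent as DATA `lineArchType` with `lineArchType_spec`, `archWeight_lineArchType`, `lineArchType_eq_iff`.  (The
  scalar of ANY monoid acting on a stable line is a homomorphism: `lineScalarHom`.)
* § 3 **automorphic characters**: every continuous unitary character `χ` of `[U(W)] = U(W)(L⁺)\U(W)(𝔸_{L⁺})` HAS an
  archimedean type, and exactly one — `UnitaryLineChar.existsUnique_hasArchType`; the type as DATA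
  `UnitaryLineChar.archType L χ` (`hasArchType_archType`, `archType_eq_iff`, `archType_one/_mul/_inv`), so the
  classes `{χ | HasArchType L χ m}` PARTITION the dual group (`setOf_hasArchType_eq_preimage_archType`,
  `iUnion_setOf_hasArchType`, `disjoint_setOf_hasArchType`); and the same for characters `ξ = χ′₁ ⊠ χ′₂` of the
  seesaw torus `[T] = [U(W₁) × U(W₂)]` (`SeesawTorus.existsUnique_hasArchType`, through the landed
  `SeesawTorus.hasArchType_iff_charFst_charSnd`).

Everything is proved (Mathlib + tree); no named facts; cite tags are provenance of the classification step.

## Why (Hodge-CM cell)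

PerL-type bookkeeping DEFINES the archimedean exponents of a theta datum by the torus action on the distinguished
archimedean vector: "`U(W_{i,b}) = U(1)` acts on `φ⁰_{i,b}` by a character `u ↦ u^{−e_b}`, which defines `e_b ∈ ℤ`",
and the automorphic characters `χ′` against which the theta kernel is integrated are then "of type `(e_b)_b`".  § 2 is
that definition for all places at once (`lineArchType`, with the uniqueness that makes it a definition), § 3 is the
statement that sorting ALL characters of `[U(W)]` (resp. `[T]`) by archimedean type loses none — the input of the
Fourier argument on the compact torus that places an equivariant function in the closed span of the generators of
ONE type.

## References

* [BrockerTomDieck1985] T. Bröcker, T. tom Dieck, *Representations of Compact Lie Groups*, GTM 98 (1985), Ch. II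
  Prop. (8.1) (continuous characters of `S¹` are `z ↦ z^n`), Def. (8.2) (weights of a torus action).
* [PlatonovRapinchuk1994] V. Platonov, A. Rapinchuk, *Algebraic Groups and Number Theory* (1994), § 6.2 (the
  archimedean torus of a unitary group of a CM extension) — context of `UnitaryLineArchTypes`.

## Provenance

LEAN-IN-TREE rule (2026-08-18), pub-hodgecm model-construction sub-cell, node W6b-3 (the archimedean types
`(m₁, m₂)` of the torus sides are READ OFF the constructed archimedean vector), seat mc-period-2 gen 2.
-/

set_option autoImplicit false

noncomputable section

open NumberField InfinitePlace
open Literature.RepresentationTheory.CompactGroups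

namespace Literature.NumberTheory.Automorphic

/-! ## § 1. Continuous characters of `U(W)(L⁺ ⊗ ℝ)` are typed weights -/

section TorusChars

variable (L : Type) [Field L] [NumberField L] [IsCMField L]

/-- **Every continuous character `c : U(W)(L⁺ ⊗ ℝ) →* ℂ` is `archWeight L m` for a unique type `m`.**  Existence:
restrict `c` to the one-place subtorus at `w` (`archCoord L w : U(1) →* U(W)(L⁺ ⊗ ℝ)`), read off the integer `m w`
from the classification of continuous characters of `U(1)` (`CircleChar.existsUnique_zpow_complex`), and compare
`c` with `archWeight L m` on the subtori (`monoidHom_ext_archCoord`); uniqueness is `archWeight_injective`.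
[cite: BrockerTomDieck1985, Ch. II Prop. 8.1] -/
theorem existsUnique_archWeight_eq (c : relNormOneInfUnits (maximalRealSubfield L) L →* ℂ) (hc : Continuous c) :
    ∃! m : InfinitePlace L → ℤ, archWeight L m = c := by
  have h : ∀ w : InfinitePlace L, ∃ n : ℤ, ∀ z : Circle, c (archCoord L w z) = (z : ℂ) ^ n := fun w =>
    (CircleChar.existsUnique_zpow_complex (c.comp (archCoord L w))
      (hc.comp (continuous_archCoord L w))).exists
  choose n hn using h
  have h0 : archWeight L n = c := monoidHom_ext_archCoord L fun w z => by
    rw [archWeight_archCoord, Circle.coe_zpow, hn w z]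
  exact ⟨n, h0, fun m hm => archWeight_injective (hm.trans h0.symm)⟩

/-- **Circle-valued form**: every continuous character `χ : U(W)(L⁺ ⊗ ℝ) →* U(1)` is `archWeightCircle L m` for a
unique `m`. [cite: BrockerTomDieck1985, Ch. II Prop. 8.1] -/
theorem existsUnique_archWeightCircle_eq (χ : relNormOneInfUnits (maximalRealSubfield L) L →* Circle)
    (hχ : Continuous χ) : ∃! m : InfinitePlace L → ℤ, archWeightCircle L m = χ := by
  have hc : Continuous (Circle.coeHom.comp χ) := continuous_subtype_val.comp hχ
  obtain ⟨m, hm, -⟩ := existsUnique_archWeight_eq L (Circle.coeHom.comp χ) hc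
  have hmc : archWeightCircle L m = χ := MonoidHom.ext fun t => Circle.ext (by
    have := DFunLike.congr_fun hm t
    rwa [archWeight_apply] at this)
  exact ⟨m, hmc, fun m' hm' => archWeightCircle_injective (hm'.trans hmc.symm)⟩

/-- A continuous character of the archimedean torus is automatically unitary. [folklore] -/
theorem norm_eq_one_of_continuous (c : relNormOneInfUnits (maximalRealSubfield L) L →* ℂ) (hc : Continuous c)
    (t : relNormOneInfUnits (maximalRealSubfield L) L) : ‖c t‖ = 1 := by
  obtain ⟨m, hm, -⟩ := existsUnique_archWeight_eq L c hc
  rw [← hm, norm_archWeight]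

/-- **The archimedean type of a continuous character** `c : U(W)(L⁺ ⊗ ℝ) →* ℂ` (DATA: the unique `m` with
`archWeight L m = c`). [cite: BrockerTomDieck1985, Ch. II Def. 8.2] -/
def charArchType (c : relNormOneInfUnits (maximalRealSubfield L) L →* ℂ) (hc : Continuous c) :
    InfinitePlace L → ℤ :=
  Classical.choose (existsUnique_archWeight_eq L c hc).exists

/-- Defining property of `charArchType`: `archWeight L (charArchType L c hc) = c`. [folklore] -/
@[simp] theorem archWeight_charArchType (c : relNormOneInfUnits (maximalRealSubfield L) L →* ℂ)
    (hc : Continuous c) : archWeight L (charArchType L c hc) = c :=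
  Classical.choose_spec (existsUnique_archWeight_eq L c hc).exists

/-- Pointwise form: `c t = ∏_w ι_w(t_w) ^ (charArchType L c hc w)`. [folklore] -/
theorem charArchType_spec (c : relNormOneInfUnits (maximalRealSubfield L) L →* ℂ) (hc : Continuous c)
    (t : relNormOneInfUnits (maximalRealSubfield L) L) : c t = archWeight L (charArchType L c hc) t := by
  rw [archWeight_charArchType]

/-- `charArchType L c hc = m ↔ archWeight L m = c`. [folklore] -/
theorem charArchType_eq_iff (c : relNormOneInfUnits (maximalRealSubfield L) L →* ℂ) (hc : Continuous c)
    (m : InfinitePlace L → ℤ) : charArchType L c hc = m ↔ archWeight L m = c := by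
  constructor
  · rintro rfl
    exact archWeight_charArchType L c hc
  · intro hm
    exact (existsUnique_archWeight_eq L c hc).unique (archWeight_charArchType L c hc) hm

/-- The type of the typed weight `archWeight L m` is `m`. [folklore] -/
@[simp] theorem charArchType_archWeight (m : InfinitePlace L → ℤ) :
    charArchType L (archWeight L m) (continuous_archWeight L m) = m :=
  (charArchType_eq_iff L _ _ m).mpr rfl

end TorusChars

/-! ## § 2. Stable lines: the exponents of a torus action on `ℂ φ` -/

section LineScalar

variable {G : Type*} [Monoid G] {V : Type*} [AddCommGroup V] [Module ℂ V]

/-- On a stable line through `φ ≠ 0` the scalar of the unit is `1`. [folklore] -/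
theorem lineScalar_one (ρ : G →* Module.End ℂ V) {φ : V} (hφ : φ ≠ 0) {c : G → ℂ}
    (hρ : ∀ g, ρ g φ = c g • φ) : c 1 = 1 := by
  have h : c 1 • φ = (1 : ℂ) • φ := by rw [← hρ 1, map_one, one_smul]; rfl
  exact smul_left_injective ℂ hφ h

/-- On a stable line through `φ ≠ 0` the scalars multiply. [folklore] -/
theorem lineScalar_mul (ρ : G →* Module.End ℂ V) {φ : V} (hφ : φ ≠ 0) {c : G → ℂ}
    (hρ : ∀ g, ρ g φ = c g • φ) (g h : G) : c (g * h) = c g * c h := by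
  have key : c (g * h) • φ = (c g * c h) • φ := by
    rw [← hρ (g * h), map_mul, Module.End.mul_apply, hρ h, map_smul, hρ g, smul_smul, mul_comm]
  exact smul_left_injective ℂ hφ key

/-- **The scalar character of a stable line**: if a monoid acts by `ℂ`-linear maps stabilising the line `ℂ φ`,
`φ ≠ 0`, with `ρ g φ = c g • φ`, then `c` is a monoid homomorphism `G →* ℂ`. [folklore] -/
def lineScalarHom (ρ : G →* Module.End ℂ V) {φ : V} (hφ : φ ≠ 0) (c : G → ℂ) (hρ : ∀ g, ρ g φ = c g • φ) :
    G →* ℂ where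
  toFun := c
  map_one' := lineScalar_one ρ hφ hρ
  map_mul' := lineScalar_mul ρ hφ hρ

/-- Values of `lineScalarHom` (definitional). [folklore] -/
@[simp] theorem lineScalarHom_apply (ρ : G →* Module.End ℂ V) {φ : V} (hφ : φ ≠ 0) (c : G → ℂ)
    (hρ : ∀ g, ρ g φ = c g • φ) (g : G) : lineScalarHom ρ hφ c hρ g = c g := rfl

end LineScalar

section Line

variable (L : Type) [Field L] [NumberField L] [IsCMField L]
variable {V : Type*} [AddCommGroup V] [Module ℂ V]

/-- **Weights of the archimedean torus on a stable line** (Bröcker–tom Dieck II (8.1)/(8.2) for `∏_{w ∣ ∞} U(1)`):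
if `U(W)(L⁺ ⊗ ℝ)` acts by `ℂ`-linear maps with `ρ t φ = c t • φ`, `φ ≠ 0`, and the scalar `c` is continuous, then
`ρ t φ = archWeight L m t • φ` for a UNIQUE type `m : (w ∣ ∞) → ℤ`.
[cite: BrockerTomDieck1985, Ch. II Prop. 8.1 and Def. 8.2] -/
theorem existsUnique_archWeight_of_line (ρ : relNormOneInfUnits (maximalRealSubfield L) L →* Module.End ℂ V)
    {φ : V} (hφ : φ ≠ 0) (c : relNormOneInfUnits (maximalRealSubfield L) L → ℂ) (hc : Continuous c)
    (hρ : ∀ t, ρ t φ = c t • φ) :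
    ∃! m : InfinitePlace L → ℤ, ∀ t, ρ t φ = archWeight L m t • φ := by
  obtain ⟨m, hm, hu⟩ := existsUnique_archWeight_eq L (lineScalarHom ρ hφ c hρ) hc
  refine ⟨m, fun t => ?_, fun m' hm' => hu m' (MonoidHom.ext fun t => ?_)⟩
  · rw [hρ t, ← lineScalarHom_apply ρ hφ c hρ t, ← hm]
  · rw [lineScalarHom_apply]
    exact smul_left_injective ℂ hφ ((hm' t).symm.trans (hρ t))

/-- **The same with a continuous ORBIT instead of a continuous scalar**: in a Hausdorff topological vector space the
line `ℂ φ` is closed-embedded (`isClosedEmbedding_smul_left`), so continuity of `t ↦ ρ t φ` is continuity of the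
scalar. [cite: BrockerTomDieck1985, Ch. II Prop. 8.1 and Def. 8.2] -/
theorem existsUnique_archWeight_of_line_of_continuous [TopologicalSpace V] [IsTopologicalAddGroup V]
    [ContinuousSMul ℂ V] [T2Space V] (ρ : relNormOneInfUnits (maximalRealSubfield L) L →* Module.End ℂ V)
    {φ : V} (hφ : φ ≠ 0) (hline : ∀ t, ∃ a : ℂ, ρ t φ = a • φ) (hcont : Continuous fun t => ρ t φ) :
    ∃! m : InfinitePlace L → ℤ, ∀ t, ρ t φ = archWeight L m t • φ := by
  choose c hc using hline
  refine existsUnique_archWeight_of_line L ρ hφ c ?_ hc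
  have heq : (fun t => ρ t φ) = (fun a : ℂ => a • φ) ∘ c := funext fun t => by simp [hc t]
  rw [heq] at hcont
  exact (isClosedEmbedding_smul_left (𝕜 := ℂ) hφ).isInducing.continuous_iff.mpr hcont

/-- **The archimedean type of a stable line** (DATA) — the multi-place form of "`U(1)` acts on `φ⁰` by
`u ↦ u^{k}`, which DEFINES `k ∈ ℤ`": the unique `m` with `ρ t φ = archWeight L m t • φ`.
[cite: BrockerTomDieck1985, Ch. II Def. 8.2] -/
def lineArchType (ρ : relNormOneInfUnits (maximalRealSubfield L) L →* Module.End ℂ V) {φ : V} (hφ : φ ≠ 0)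
    (c : relNormOneInfUnits (maximalRealSubfield L) L → ℂ) (hc : Continuous c) (hρ : ∀ t, ρ t φ = c t • φ) :
    InfinitePlace L → ℤ :=
  Classical.choose (existsUnique_archWeight_of_line L ρ hφ c hc hρ).exists

/-- Defining property of `lineArchType`: `ρ t φ = archWeight L (lineArchType …) t • φ`. [folklore] -/
theorem lineArchType_spec (ρ : relNormOneInfUnits (maximalRealSubfield L) L →* Module.End ℂ V) {φ : V}
    (hφ : φ ≠ 0) (c : relNormOneInfUnits (maximalRealSubfield L) L → ℂ) (hc : Continuous c)
    (hρ : ∀ t, ρ t φ = c t • φ) (t : relNormOneInfUnits (maximalRealSubfield L) L) :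
    ρ t φ = archWeight L (lineArchType L ρ hφ c hc hρ) t • φ :=
  Classical.choose_spec (existsUnique_archWeight_of_line L ρ hφ c hc hρ).exists t

/-- The scalar IS the typed weight of the line's type: `archWeight L (lineArchType …) t = c t`. [folklore] -/
theorem archWeight_lineArchType (ρ : relNormOneInfUnits (maximalRealSubfield L) L →* Module.End ℂ V) {φ : V}
    (hφ : φ ≠ 0) (c : relNormOneInfUnits (maximalRealSubfield L) L → ℂ) (hc : Continuous c)
    (hρ : ∀ t, ρ t φ = c t • φ) (t : relNormOneInfUnits (maximalRealSubfield L) L) :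
    archWeight L (lineArchType L ρ hφ c hc hρ) t = c t :=
  smul_left_injective ℂ hφ ((lineArchType_spec L ρ hφ c hc hρ t).symm.trans (hρ t))

/-- `lineArchType … = m ↔ ∀ t, ρ t φ = archWeight L m t • φ`. [folklore] -/
theorem lineArchType_eq_iff (ρ : relNormOneInfUnits (maximalRealSubfield L) L →* Module.End ℂ V) {φ : V}
    (hφ : φ ≠ 0) (c : relNormOneInfUnits (maximalRealSubfield L) L → ℂ) (hc : Continuous c)
    (hρ : ∀ t, ρ t φ = c t • φ) (m : InfinitePlace L → ℤ) :
    lineArchType L ρ hφ c hc hρ = m ↔ ∀ t, ρ t φ = archWeight L m t • φ := by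
  constructor
  · rintro rfl
    exact lineArchType_spec L ρ hφ c hc hρ
  · intro hm
    exact (existsUnique_archWeight_of_line L ρ hφ c hc hρ).unique (lineArchType_spec L ρ hφ c hc hρ) hm

/-- The line type is the character type of the scalar character. [folklore] -/
theorem lineArchType_eq_charArchType (ρ : relNormOneInfUnits (maximalRealSubfield L) L →* Module.End ℂ V)
    {φ : V} (hφ : φ ≠ 0) (c : relNormOneInfUnits (maximalRealSubfield L) L → ℂ) (hc : Continuous c)
    (hρ : ∀ t, ρ t φ = c t • φ) :
    lineArchType L ρ hφ c hc hρ = charArchType L (lineScalarHom ρ hφ c hρ) hc := by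
  symm
  rw [charArchType_eq_iff]
  exact MonoidHom.ext fun t => archWeight_lineArchType L ρ hφ c hc hρ t

end Line

/-! ## § 3. Automorphic characters: every character of `[U(W)]` has exactly one archimedean type -/

namespace UnitaryLineChar

variable (L : Type) [Field L] [NumberField L] [IsCMField L]

/-- **Every continuous unitary character of `[U(W)]` has an archimedean type, and exactly one.**
[cite: BrockerTomDieck1985, Ch. II Prop. 8.1] -/
theorem existsUnique_hasArchType (χ : ContinuousMonoidHom (relNormOneIdeles (maximalRealSubfield L) L ⧸
      relNormOneRat (maximalRealSubfield L) L) Circle) : ∃! m : InfinitePlace L → ℤ, HasArchType L χ m := by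
  have hc : Continuous ((χ : (relNormOneIdeles (maximalRealSubfield L) L ⧸ relNormOneRat (maximalRealSubfield L) L)
      →* Circle).comp (relNormOneInfToQuot (maximalRealSubfield L) L)) :=
    χ.continuous.comp (continuous_relNormOneInfToQuot (maximalRealSubfield L) L)
  obtain ⟨m, hm, -⟩ := existsUnique_archWeightCircle_eq L _ hc
  have hmType : HasArchType L χ m := fun y => by
    have := DFunLike.congr_fun hm y
    rw [MonoidHom.comp_apply] at this
    exact this.symm
  exact ⟨m, hmType, fun m' hm' => hm'.unique hmType⟩

/-- **The archimedean type of a character of `[U(W)]`** (DATA): the unique `m` with `HasArchType L χ m`.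
[cite: BrockerTomDieck1985, Ch. II Def. 8.2] -/
def archType (χ : ContinuousMonoidHom (relNormOneIdeles (maximalRealSubfield L) L ⧸
      relNormOneRat (maximalRealSubfield L) L) Circle) : InfinitePlace L → ℤ :=
  Classical.choose (existsUnique_hasArchType L χ).exists

/-- Defining property: `χ` has archimedean type `archType L χ`. [folklore] -/
theorem hasArchType_archType (χ : ContinuousMonoidHom (relNormOneIdeles (maximalRealSubfield L) L ⧸
      relNormOneRat (maximalRealSubfield L) L) Circle) : HasArchType L χ (archType L χ) :=
  Classical.choose_spec (existsUnique_hasArchType L χ).exists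

variable {L}

/-- `archType L χ = m ↔ HasArchType L χ m`. [folklore] -/
theorem archType_eq_iff {χ : ContinuousMonoidHom (relNormOneIdeles (maximalRealSubfield L) L ⧸
      relNormOneRat (maximalRealSubfield L) L) Circle} {m : InfinitePlace L → ℤ} :
    archType L χ = m ↔ HasArchType L χ m := by
  constructor
  · rintro rfl
    exact hasArchType_archType L χ
  · intro hm
    exact (hasArchType_archType L χ).unique hm

/-- A character of type `m` has `archType = m`. [folklore] -/
theorem HasArchType.archType_eq {χ : ContinuousMonoidHom (relNormOneIdeles (maximalRealSubfield L) L ⧸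
      relNormOneRat (maximalRealSubfield L) L) Circle} {m : InfinitePlace L → ℤ} (h : HasArchType L χ m) :
    archType L χ = m :=
  archType_eq_iff.mpr h

/-- The values of `χ` on the archimedean torus are the typed weight of its type. [folklore] -/
theorem coe_apply_relNormOneInfToQuot (χ : ContinuousMonoidHom (relNormOneIdeles (maximalRealSubfield L) L ⧸
      relNormOneRat (maximalRealSubfield L) L) Circle) (y : relNormOneInfUnits (maximalRealSubfield L) L) :
    ((χ (relNormOneInfToQuot (maximalRealSubfield L) L y) : Circle) : ℂ) = archWeight L (archType L χ) y :=
  (hasArchType_iff L χ _).mp (hasArchType_archType L χ) y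

variable (L) in
/-- The trivial character has type `0`. [folklore] -/
@[simp] theorem archType_one : archType L (1 : ContinuousMonoidHom (relNormOneIdeles (maximalRealSubfield L) L ⧸
      relNormOneRat (maximalRealSubfield L) L) Circle) = 0 :=
  (hasArchType_one L).archType_eq

/-- Types add under products. [folklore] -/
theorem archType_mul (χ χ' : ContinuousMonoidHom (relNormOneIdeles (maximalRealSubfield L) L ⧸
      relNormOneRat (maximalRealSubfield L) L) Circle) : archType L (χ * χ') = archType L χ + archType L χ' :=
  ((hasArchType_archType L χ).mul L (hasArchType_archType L χ')).archType_eq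

/-- The inverse (= conjugate) character has the opposite type. [folklore] -/
theorem archType_inv (χ : ContinuousMonoidHom (relNormOneIdeles (maximalRealSubfield L) L ⧸
      relNormOneRat (maximalRealSubfield L) L) Circle) : archType L χ⁻¹ = -archType L χ :=
  (hasArchType_archType L χ).inv.archType_eq

/-- The class of characters of type `m` is the fibre of `archType` over `m`. [folklore] -/
theorem setOf_hasArchType_eq_preimage_archType (m : InfinitePlace L → ℤ) :
    {χ : ContinuousMonoidHom (relNormOneIdeles (maximalRealSubfield L) L ⧸
        relNormOneRat (maximalRealSubfield L) L) Circle | HasArchType L χ m} = archType L ⁻¹' {m} := by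
  ext χ
  simp only [Set.mem_setOf_eq, Set.mem_preimage, Set.mem_singleton_iff]
  exact archType_eq_iff.symm

variable (L) in
/-- **The type classes cover the dual group**: every character lies in the class of its type. [folklore] -/
theorem iUnion_setOf_hasArchType :
    ⋃ m : InfinitePlace L → ℤ, {χ : ContinuousMonoidHom (relNormOneIdeles (maximalRealSubfield L) L ⧸
        relNormOneRat (maximalRealSubfield L) L) Circle | HasArchType L χ m} = Set.univ := by
  refine Set.eq_univ_of_forall fun χ => Set.mem_iUnion.mpr ⟨archType L χ, ?_⟩
  exact hasArchType_archType L χ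

/-- **The type classes are pairwise disjoint.** [folklore] -/
theorem disjoint_setOf_hasArchType {m m' : InfinitePlace L → ℤ} (h : m ≠ m') :
    Disjoint {χ : ContinuousMonoidHom (relNormOneIdeles (maximalRealSubfield L) L ⧸
        relNormOneRat (maximalRealSubfield L) L) Circle | HasArchType L χ m}
      {χ | HasArchType L χ m'} := by
  rw [Set.disjoint_left]
  intro χ hχ hχ'
  exact h (HasArchType.unique hχ hχ')

end UnitaryLineChar

/-! ### The seesaw torus `[T] = [U(W₁) × U(W₂)]` -/

namespace SeesawTorus

variable (L : Type) [Field L] [NumberField L] [IsCMField L]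

/-- **Every character `ξ = χ′₁ ⊠ χ′₂` of `[T]` has exactly one archimedean type `(m₁, m₂)`** — namely the pair of
types of its two components (`hasArchType_iff_charFst_charSnd`). [cite: BrockerTomDieck1985, Ch. II Prop. 8.1] -/
theorem existsUnique_hasArchType
    (ξ : ContinuousMonoidHom (SeesawTorus (maximalRealSubfield L) L ⧸ rat (maximalRealSubfield L) L) Circle) :
    ∃! mm : (InfinitePlace L → ℤ) × (InfinitePlace L → ℤ), HasArchType L ξ mm.1 mm.2 := by
  refine ⟨(UnitaryLineChar.archType L (charFst ξ), UnitaryLineChar.archType L (charSnd ξ)), ?_, ?_⟩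
  · exact (hasArchType_iff_charFst_charSnd ξ _ _).mpr
      ⟨UnitaryLineChar.hasArchType_archType L _, UnitaryLineChar.hasArchType_archType L _⟩
  · rintro ⟨m₁, m₂⟩ h
    obtain ⟨h₁, h₂⟩ := (hasArchType_iff_charFst_charSnd ξ m₁ m₂).mp h
    exact Prod.ext h₁.archType_eq.symm h₂.archType_eq.symm

/-- The type of `ξ` read on the components: `ξ` has type `(archType χ′₁, archType χ′₂)`. [folklore] -/
theorem hasArchType_archType_charFst_charSnd
    (ξ : ContinuousMonoidHom (SeesawTorus (maximalRealSubfield L) L ⧸ rat (maximalRealSubfield L) L) Circle) :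
    HasArchType L ξ (UnitaryLineChar.archType L (charFst ξ)) (UnitaryLineChar.archType L (charSnd ξ)) :=
  (hasArchType_iff_charFst_charSnd ξ _ _).mpr
    ⟨UnitaryLineChar.hasArchType_archType L _, UnitaryLineChar.hasArchType_archType L _⟩

variable {L} in
/-- A character of `[T]` of type `(m₁, m₂)` has components of types `m₁`, `m₂` read as `archType`. [folklore] -/
theorem HasArchType.archType_eq
    {ξ : ContinuousMonoidHom (SeesawTorus (maximalRealSubfield L) L ⧸ rat (maximalRealSubfield L) L) Circle}
    {m₁ m₂ : InfinitePlace L → ℤ} (h : HasArchType L ξ m₁ m₂) :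
    UnitaryLineChar.archType L (charFst ξ) = m₁ ∧ UnitaryLineChar.archType L (charSnd ξ) = m₂ := by
  obtain ⟨h₁, h₂⟩ := (hasArchType_iff_charFst_charSnd ξ m₁ m₂).mp h
  exact ⟨h₁.archType_eq, h₂.archType_eq⟩

end SeesawTorus

end Literature.NumberTheory.Automorphic

end
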